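import Mathlib
import HarnessLib
import Summits.Parity.GeneralizedHardyLittlewood.Theses.LeeYangFibres
import Summits.Parity.GeneralizedHardyLittlewood.Theorems.LeeYangFibresFibreHyperbolicityDefs
import Summits.Parity.GeneralizedHardyLittlewood.Theorems.LeeYangFibresHyperbolicityClipsParityNewton
import Summits.Parity.GeneralizedHardyLittlewood.Theorems.LeeYangFibresFibreHyperbolicityPrimeColumn

/-!
# Crux `FibreHyperbolicity` (stmt-Parity-14108): the prime columns are themselves hyperbolic

Strong form of the necessity theorem of `…FibreHyperbolicityPrimeColumn` (line "model transfer", lead seat c1),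
unconditional and sorry-free. For a coordinate `i` of a `t`-form system let
`P_m = C_{(m;1,…,1)}` (`jointCell` at `Function.update (fun _ => 1) i m`) be the PRIME COLUMN: the `n ∈ K ∩ ℤ` with
`Ω(ψ_i(n)) = m`, `ψ_i(n)` `N^{1/u}`-rough and `ψ_k(n)` PRIME (`> N^{1/u}`) for every `k ≠ i`. We prove

* `norm_sq_eval_ge_of_roots_real` — for a real polynomial `Q ≠ 0` with non-negative coefficients and only real
  (hence non-positive) roots, `deg Q ≤ d`, and any `z ∈ ℂ`:
  `(‖z‖ + Re z)^d · Q(‖z‖)² ≤ (2‖z‖)^d · ‖Q(z)‖²` — from `Q = c ∏ (X + s_l)`, `s_l ≥ 0`, and the one-factor inequality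
  `(‖z‖ + Re z)(‖z‖ + s)² ≤ 2‖z‖ · ‖z + s‖²` (whose slack is `(‖z‖ − Re z)(‖z‖ − s)²`);
* `primeColumn_hyperbolic_of_FHAt` — `FHAt t` forces, with its own `u, N₀`, for every admissible `(Ψ, K)` with
  `β_∞ 𝔖 ≥ ηN` and every `i`: EITHER the prime column vanishes identically (`P_m = 0` for `1 ≤ m ≤ u`) OR the
  prime-column polynomial `Σ_{m=1}^{u} P_m ζ^m` has only real zeros. Proof: at equal frozen fugacities `w` the fibre is
  `w^{t-1} Σ_m P_m ζ^m + E_w(ζ)` with `‖E_w(ζ)‖ ≤ w^t B Σ_m ‖ζ‖^m`; at a non-real zero `ζ` of the column polynomial the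
  lower bound above (the fibre is real-rooted by `FHAt t`, its value at `‖ζ‖` is `≥ w^{t-1} Σ_m P_m ‖ζ‖^m`) contradicts
  the upper bound as `w → 0⁺`;
* `primeColumn_hyperbolic_of_fibreHyperbolicity` — the same from the crux verbatim (`t ≥ 1`).

So the crux CONTAINS, for `t = 2` and `Ψ = (n, n + 2)`, the real-rootedness of the Ω-cell polynomial of the rough
`n ∈ K` with `n + 2` prime — the zero-locus statement about shifted primes that the line's residue analysis identified
as the wall every proof must climb (log-concavity, file `…PrimeColumn`, is its Newton shadow).
-/

noncomputable section

namespace Summit.Parity.GeneralizedHardyLittlewood.Cruxes.FibreHyperbolicity.ModelTransfer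

open scoped BigOperators Classical Polynomial
open Finset Polynomial
open Literature.NumberTheory.Sieve
open Summit.Parity.GeneralizedHardyLittlewood.Theses.LeeYangFibres (FibreHyperbolicity)
open Summit.Parity.GeneralizedHardyLittlewood.Theorems.HyperbolicityClipsParity
  (eq_C_mul_prod_X_add_C_of_roots_real)

/-! ## A lower bound for real-rooted polynomials with non-negative coefficients -/

/-- One factor: `(‖z‖ + Re z)(‖z‖ + s)² ≤ 2‖z‖ · ‖z + s‖²` for real `s` (the slack is `(‖z‖ − Re z)(‖z‖ − s)²`). -/
theorem norm_add_ofReal_sq_ge (z : ℂ) (s : ℝ) :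
    (‖z‖ + z.re) * (‖z‖ + s) ^ 2 ≤ 2 * ‖z‖ * ‖z + (s : ℂ)‖ ^ 2 := by
  have h1 : ‖z‖ ^ 2 = z.re ^ 2 + z.im ^ 2 := by
    rw [Complex.sq_norm, Complex.normSq_apply]; ring
  have h2 : ‖z + (s : ℂ)‖ ^ 2 = (z.re + s) ^ 2 + z.im ^ 2 := by
    rw [Complex.sq_norm, Complex.normSq_apply, Complex.add_re, Complex.add_im, Complex.ofReal_re,
      Complex.ofReal_im]
    ring
  have hx : z.re ≤ ‖z‖ := Complex.re_le_norm z
  have hρ : 0 ≤ ‖z‖ := norm_nonneg z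
  nlinarith [mul_nonneg (sub_nonneg.2 hx) (sq_nonneg (‖z‖ - s)), mul_nonneg hρ (sq_nonneg (z.re + s)),
    h1, h2]

/-- Product form: for `Q = c · ∏_{s ∈ S} (X + s)`,
`(‖z‖ + Re z)^{#S} Q(‖z‖)² ≤ (2‖z‖)^{#S} ‖Q(z)‖²`. -/
theorem norm_sq_eval_prod_ge (z : ℂ) (c : ℝ) (S : Multiset ℝ) :
    (‖z‖ + z.re) ^ Multiset.card S * ((C c * (S.map fun s => X + C s).prod).eval ‖z‖) ^ 2 ≤
      (2 * ‖z‖) ^ Multiset.card S *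
        ‖((C c * (S.map fun s => X + C s).prod).map (algebraMap ℝ ℂ)).eval z‖ ^ 2 := by
  induction S using Multiset.induction_on with
  | empty =>
      simp only [Multiset.card_zero, pow_zero, one_mul, Multiset.map_zero, Multiset.prod_zero, mul_one,
        eval_C, Polynomial.map_C]
      rw [Complex.coe_algebraMap, Complex.norm_real, Real.norm_eq_abs, sq_abs]
  | cons s S ih =>
      have hx : -‖z‖ ≤ z.re := (abs_le.mp (Complex.abs_re_le_norm z)).1
      have hρx : 0 ≤ ‖z‖ + z.re := by linarith
      have e1 : C c * ((s ::ₘ S).map fun s => X + C s).prod =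
          C c * (S.map fun s => X + C s).prod * (X + C s) := by
        rw [Multiset.map_cons, Multiset.prod_cons]; ring
      have e2 : (C c * (S.map fun s => X + C s).prod * (X + C s)).eval ‖z‖ =
          (C c * (S.map fun s => X + C s).prod).eval ‖z‖ * (‖z‖ + s) := by
        rw [eval_mul, eval_add, eval_X, eval_C]
      have e3 : ((C c * (S.map fun s => X + C s).prod * (X + C s)).map (algebraMap ℝ ℂ)).eval z =
          ((C c * (S.map fun s => X + C s).prod).map (algebraMap ℝ ℂ)).eval z * (z + (s : ℂ)) := by
        rw [Polynomial.map_mul, eval_mul, Polynomial.map_add, Polynomial.map_X, Polynomial.map_C, eval_add, eval_X,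
          eval_C, Complex.coe_algebraMap]
      rw [Multiset.card_cons, e1, e2, e3, norm_mul]
      set A : ℝ := (C c * (S.map fun s => X + C s).prod).eval ‖z‖ with hA
      set Bz : ℝ := ‖((C c * (S.map fun s => X + C s).prod).map (algebraMap ℝ ℂ)).eval z‖ with hBz
      have k1 := norm_add_ofReal_sq_ge z s
      calc (‖z‖ + z.re) ^ (Multiset.card S + 1) * (A * (‖z‖ + s)) ^ 2
          = ((‖z‖ + z.re) ^ Multiset.card S * A ^ 2) * ((‖z‖ + z.re) * (‖z‖ + s) ^ 2) := by ring
        _ ≤ ((2 * ‖z‖) ^ Multiset.card S * Bz ^ 2) * (2 * ‖z‖ * ‖z + (s : ℂ)‖ ^ 2) :=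
            mul_le_mul ih k1 (by positivity) (by positivity)
        _ = (2 * ‖z‖) ^ (Multiset.card S + 1) * (Bz * ‖z + (s : ℂ)‖) ^ 2 := by ring

/-- **Lower bound off the real axis.** If `Q ≠ 0` has non-negative coefficients, only real complex roots and
`deg Q ≤ d`, then for every `z ∈ ℂ`: `(‖z‖ + Re z)^d · Q(‖z‖)² ≤ (2‖z‖)^d · ‖Q(z)‖²`.
(By `eq_C_mul_prod_X_add_C_of_roots_real`, `Q = c ∏ (X + s_l)` with `s_l ≥ 0`; then `norm_sq_eval_prod_ge`, and
`0 ≤ ‖z‖ + Re z ≤ 2‖z‖` upgrades the exponent `deg Q` to `d`.) -/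
theorem norm_sq_eval_ge_of_roots_real {Q : ℝ[X]} (hQ : Q ≠ 0) (h0 : ∀ n, 0 ≤ Q.coeff n)
    (hroots : ∀ z : ℂ, (Q.map (algebraMap ℝ ℂ)).eval z = 0 → z.im = 0) (z : ℂ) {d : ℕ}
    (hd : Q.natDegree ≤ d) :
    (‖z‖ + z.re) ^ d * (Q.eval ‖z‖) ^ 2 ≤ (2 * ‖z‖) ^ d * ‖(Q.map (algebraMap ℝ ℂ)).eval z‖ ^ 2 := by
  obtain ⟨S, -, hQS⟩ := eq_C_mul_prod_X_add_C_of_roots_real hQ h0 hroots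
  set c : ℝ := Q.leadingCoeff with hc
  have hc0 : c ≠ 0 := leadingCoeff_ne_zero.mpr hQ
  -- `#S = deg Q ≤ d`
  have hcard : Multiset.card S ≤ d := by
    have hdeg : (C c * (S.map fun s => X + C s).prod).natDegree = Multiset.card S := by
      rw [natDegree_C_mul hc0, natDegree_multiset_prod_of_monic]
      · rw [Multiset.map_map]
        have : (S.map (natDegree ∘ fun s : ℝ => X + C s)) = S.map (fun _ => 1) :=
          Multiset.map_congr rfl fun s _ => by simp
        rw [this, Multiset.map_const', Multiset.sum_replicate, smul_eq_mul, mul_one]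
      · intro f hf
        obtain ⟨s, -, rfl⟩ := Multiset.mem_map.mp hf
        exact monic_X_add_C s
    rw [← hQS] at hdeg
    omega
  have hx : -‖z‖ ≤ z.re := (abs_le.mp (Complex.abs_re_le_norm z)).1
  have hρx0 : 0 ≤ ‖z‖ + z.re := by linarith
  have hρx2 : ‖z‖ + z.re ≤ 2 * ‖z‖ := by linarith [Complex.re_le_norm z]
  have key := norm_sq_eval_prod_ge z c S
  rw [← hQS] at key
  calc (‖z‖ + z.re) ^ d * (Q.eval ‖z‖) ^ 2
      = (‖z‖ + z.re) ^ (d - Multiset.card S) * ((‖z‖ + z.re) ^ Multiset.card S * (Q.eval ‖z‖) ^ 2) := by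
          rw [← mul_assoc, ← pow_add, Nat.sub_add_cancel hcard]
    _ ≤ (2 * ‖z‖) ^ (d - Multiset.card S) *
          ((2 * ‖z‖) ^ Multiset.card S * ‖(Q.map (algebraMap ℝ ℂ)).eval z‖ ^ 2) :=
          mul_le_mul (pow_le_pow_left₀ hρx0 hρx2 _) key (by positivity) (by positivity)
    _ = (2 * ‖z‖) ^ d * ‖(Q.map (algebraMap ℝ ℂ)).eval z‖ ^ 2 := by
          rw [← mul_assoc, ← pow_add, Nat.sub_add_cancel hcard]

/-! ## The column image inside the box -/

/-- The column indices `(m; 1, …, 1)`, `1 ≤ m ≤ u`, form an injective image of `[1,u]` inside the box `[1,u]^t`. -/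
theorem column_image_subset_box {t : ℕ} (i : Fin t) (u : ℕ) :
    (Finset.Icc 1 u).image (fun m => Function.update (fun _ : Fin t => (1 : ℕ)) i m) ⊆
      Fintype.piFinset (fun _ : Fin t => Finset.Icc 1 u) := by
  intro j hj
  obtain ⟨m, hm, rfl⟩ := Finset.mem_image.mp hj
  exact update_mem_box i (Finset.mem_Icc.mp hm).1 (Finset.mem_Icc.mp hm).2

/-- Injectivity of `m ↦ (m; 1, …, 1)`. -/
theorem column_injOn {t : ℕ} (i : Fin t) (s : Set ℕ) :
    Set.InjOn (fun m => Function.update (fun _ : Fin t => (1 : ℕ)) i m) s := by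
  intro a _ b _ hab
  have h := congrFun hab i
  simpa using h

/-- Off the column image the frozen exponent is `≥ t`. -/
theorem le_frozenExp_of_not_mem_image {t u : ℕ} (i : Fin t) {j : Fin t → ℕ}
    (hj : j ∈ Fintype.piFinset (fun _ : Fin t => Finset.Icc 1 u))
    (hjI : j ∉ (Finset.Icc 1 u).image (fun m => Function.update (fun _ : Fin t => (1 : ℕ)) i m)) :
    t ≤ ∑ k ∈ Finset.univ.erase i, j k := by
  refine le_frozenExp_of_ne i hj rfl fun h => hjI ?_
  exact Finset.mem_image.mpr ⟨j i, Fintype.mem_piFinset.mp hj i, h.symm⟩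

/-! ## Prime columns are hyperbolic -/

/-- **The crux at `t` forms forces every prime column to be real-rooted or zero.** If `FHAt t` holds then, with
its own `u ≥ max(u₀,2)` and `N₀`: for `N ≥ N₀`, every admissible `(Ψ, K)` with `β_∞ 𝔖 ≥ ηN` and every coordinate
`i`, either `C_{(m;1,…,1)} = 0` for all `1 ≤ m ≤ u`, or the prime-column polynomial `Σ_{m=1}^u C_{(m;1,…,1)} ζ^m` has
only real zeros. -/
theorem primeColumn_hyperbolic_of_FHAt {t : ℕ} (hF : FHAt t) :
    ∀ (L u₀ : ℕ) (η : ℝ), 0 < η → ∃ u : ℕ, u₀ ≤ u ∧ 2 ≤ u ∧ ∃ N₀ : ℕ, ∀ N : ℕ, N₀ ≤ N →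
      ∀ Ψ : Fin t → AffLinForm 1, IsNondegenerateSystem Ψ → affLinSize Ψ N ≤ L →
      ∀ K : Set (Fin 1 → ℝ), Convex ℝ K → K ⊆ realBox 1 N →
      η * (N : ℝ) ≤ archFactor Ψ K * singularProduct Ψ → ∀ i : Fin t,
        (∀ m ∈ Finset.Icc 1 u, jointCell t N u Ψ K (Function.update (fun _ => 1) i m) = 0) ∨
        ∀ z : ℂ, (∑ m ∈ Finset.Icc 1 u,
            ((jointCell t N u Ψ K (Function.update (fun _ => 1) i m) : ℕ) : ℂ) * z ^ m) = 0 → z.im = 0 := by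
  intro L u₀ η hη
  obtain ⟨u, hu₀, hu2, N₀, hN₀⟩ := hF L u₀ η hη
  refine ⟨u, hu₀, hu2, N₀, fun N hN Ψ hΨ hsize K hK hKN hmass i => ?_⟩
  by_cases hzero : ∀ m ∈ Finset.Icc 1 u, jointCell t N u Ψ K (Function.update (fun _ => 1) i m) = 0
  · exact Or.inl hzero
  refine Or.inr fun z hz => ?_
  by_contra him
  push Not at hzero
  obtain ⟨m₀, hm₀, hm₀ne⟩ := hzero
  have ht1 : 1 ≤ t := Nat.succ_le_of_lt (lt_of_le_of_lt (Nat.zero_le _) i.isLt)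
  -- the data
  set box := Fintype.piFinset (fun _ : Fin t => Finset.Icc 1 u) with hbox
  set e : ℕ → (Fin t → ℕ) := fun m => Function.update (fun _ : Fin t => (1 : ℕ)) i m with he
  set C : (Fin t → ℕ) → ℝ := fun j => (jointCell t N u Ψ K j : ℝ) with hCdef
  have hC0 : ∀ j, 0 ≤ C j := fun j => Nat.cast_nonneg _
  set ρ : ℝ := ‖z‖ with hρ
  have hz0 : z ≠ 0 := fun h => him (by rw [h]; simp)
  have hρpos : 0 < ρ := norm_pos_iff.mpr hz0
  -- `ρ + Re z > 0` off the real axis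
  have h1 : ρ ^ 2 = z.re ^ 2 + z.im ^ 2 := by rw [hρ, Complex.sq_norm, Complex.normSq_apply]; ring
  have hρx : 0 < ρ + z.re := by
    have him2 : 0 < z.im ^ 2 := by positivity
    by_contra hle
    push Not at hle
    nlinarith [mul_nonneg (neg_nonneg.mpr hle) (sub_nonneg.mpr (show z.re ≤ ρ from Complex.re_le_norm z))]
  -- the column weight `S = Σ_m P_m ρ^m > 0`, the size `R = Σ_m ρ^m`, the total count `B`
  set S : ℝ := ∑ m ∈ Finset.Icc 1 u, C (e m) * ρ ^ m with hS
  have hSpos : 0 < S := by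
    have hle : C (e m₀) * ρ ^ m₀ ≤ S :=
      Finset.single_le_sum (f := fun m => C (e m) * ρ ^ m)
        (fun m _ => mul_nonneg (hC0 _) (pow_nonneg hρpos.le m)) hm₀
    have hpos : 0 < C (e m₀) * ρ ^ m₀ := by
      refine mul_pos ?_ (pow_pos hρpos _)
      simp only [hCdef, he]
      exact_mod_cast Nat.pos_of_ne_zero hm₀ne
    linarith
  set R : ℝ := ∑ m ∈ Finset.Icc 1 u, ρ ^ m with hR
  have hR0 : 0 ≤ R := Finset.sum_nonneg fun m _ => pow_nonneg hρpos.le m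
  set B : ℝ := ∑ j ∈ box, C j with hB
  have hB0 : 0 ≤ B := Finset.sum_nonneg fun j _ => hC0 j
  -- the column polynomial vanishes at `z` (hypothesis), in real-coefficient form
  have hzR : (∑ m ∈ Finset.Icc 1 u, ((C (e m) : ℝ) : ℂ) * z ^ m) = 0 := by
    rw [← hz]
    refine Finset.sum_congr rfl fun m _ => ?_
    simp only [hCdef, he, Complex.ofReal_natCast]
  -- MAIN ESTIMATE at each `0 < w ≤ 1`
  have main : ∀ w : ℝ, 0 < w → w ≤ 1 →
      (ρ + z.re) ^ u * (w ^ (t - 1) * S) ^ 2 ≤ (2 * ρ) ^ u * (w ^ t * (R * B)) ^ 2 := by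
    intro w hw0 hw1
    -- the real polynomial of the equal-fugacity fibre
    set Q : ℝ[X] := ∑ j ∈ box, Polynomial.C (C j * w ^ (∑ k ∈ Finset.univ.erase i, j k)) * X ^ (j i)
      with hQdef
    have hcoeff : ∀ m, Q.coeff m =
        ∑ j ∈ box.filter (fun j => j i = m), C j * w ^ (∑ k ∈ Finset.univ.erase i, j k) := by
      intro m
      rw [hQdef, finsetSum_coeff, Finset.sum_filter]
      refine Finset.sum_congr rfl fun j _ => ?_
      rw [coeff_C_mul_X_pow]
      by_cases h : j i = m
      · rw [if_pos h.symm, if_pos h]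
      · rw [if_neg (Ne.symm h), if_neg h]
    have h0 : ∀ n, 0 ≤ Q.coeff n := fun n => by
      rw [hcoeff]
      exact Finset.sum_nonneg fun j _ => mul_nonneg (hC0 j) (pow_nonneg hw0.le _)
    have hevalC : ∀ x : ℂ, (Q.map (algebraMap ℝ ℂ)).eval x = fibre t N u Ψ K i (fun _ => w) x := by
      intro x
      rw [fibre_const_eq, hQdef, Polynomial.map_sum, eval_finsetSum]
      refine Finset.sum_congr rfl fun j _ => ?_
      rw [Polynomial.map_mul, Polynomial.map_C, Polynomial.map_pow, Polynomial.map_X, eval_mul, eval_C,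
        eval_pow, eval_X, Complex.coe_algebraMap]
    have hroots : ∀ x : ℂ, (Q.map (algebraMap ℝ ℂ)).eval x = 0 → x.im = 0 := fun x hx =>
      hN₀ N hN Ψ hΨ hsize K hK hKN hmass i (fun _ => w) (fun _ => ⟨hw0, hw1⟩) x ((hevalC x).symm.trans hx)
    -- real evaluation at `ρ` dominates the column layer
    have hevalR : Q.eval ρ = ∑ j ∈ box, C j * w ^ (∑ k ∈ Finset.univ.erase i, j k) * ρ ^ (j i) := by
      rw [hQdef, eval_finsetSum]
      refine Finset.sum_congr rfl fun j _ => ?_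
      rw [eval_mul, eval_C, eval_pow, eval_X]
    have hlow : w ^ (t - 1) * S ≤ Q.eval ρ := by
      rw [hevalR, hS, Finset.mul_sum]
      calc ∑ m ∈ Finset.Icc 1 u, w ^ (t - 1) * (C (e m) * ρ ^ m)
          = ∑ j ∈ (Finset.Icc 1 u).image e, C j * w ^ (∑ k ∈ Finset.univ.erase i, j k) * ρ ^ (j i) := by
            rw [Finset.sum_image (column_injOn i _)]
            refine Finset.sum_congr rfl fun m _ => ?_
            simp only [he, frozenExp_update, Function.update_self]
            ring
        _ ≤ ∑ j ∈ box, C j * w ^ (∑ k ∈ Finset.univ.erase i, j k) * ρ ^ (j i) :=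
            Finset.sum_le_sum_of_subset_of_nonneg (column_image_subset_box i u) fun j _ _ =>
              mul_nonneg (mul_nonneg (hC0 j) (pow_nonneg hw0.le _)) (pow_nonneg hρpos.le _)
    have hwt : 0 < w ^ (t - 1) := pow_pos hw0 _
    have hQne : Q ≠ 0 := by
      intro h
      have h2 := hlow
      rw [h, eval_zero] at h2
      nlinarith [mul_pos hwt hSpos]
    have hdeg : Q.natDegree ≤ u := by
      rw [hQdef]
      refine natDegree_sum_le_of_forall_le _ _ fun j hj => ?_
      calc (Polynomial.C (C j * w ^ (∑ k ∈ Finset.univ.erase i, j k)) * X ^ (j i)).natDegree ≤ j i :=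
            natDegree_C_mul_X_pow_le _ _
        _ ≤ u := (Finset.mem_Icc.mp (Fintype.mem_piFinset.mp hj i)).2
    -- lower bound for `‖Q(z)‖`
    have hLB := norm_sq_eval_ge_of_roots_real hQne h0 hroots z hdeg
    -- upper bound for `‖Q(z)‖ = ‖fibre‖`: the column layer vanishes at `z`, the rest is `O(w^t)`
    have hUB : ‖(Q.map (algebraMap ℝ ℂ)).eval z‖ ≤ w ^ t * (R * B) := by
      rw [hevalC, fibre_const_eq]
      set f : (Fin t → ℕ) → ℂ := fun j =>
        (((jointCell t N u Ψ K j : ℝ) * w ^ (∑ k ∈ Finset.univ.erase i, j k) : ℝ) : ℂ) * z ^ (j i) with hf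
      have hsplit := Finset.sum_sdiff (f := f) (column_image_subset_box i u)
      -- the column layer
      have hcol : ∑ j ∈ (Finset.Icc 1 u).image e, f j = 0 := by
        rw [Finset.sum_image (column_injOn i _)]
        have : ∀ m ∈ Finset.Icc 1 u, f (e m) = ((w ^ (t - 1) : ℝ) : ℂ) * (((C (e m) : ℝ) : ℂ) * z ^ m) := by
          intro m _
          simp only [hf, he, hCdef, frozenExp_update, Function.update_self]
          push_cast
          ring
        rw [Finset.sum_congr rfl this, ← Finset.mul_sum, hzR, mul_zero]
      change ‖∑ j ∈ box, f j‖ ≤ w ^ t * (R * B)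
      rw [← hsplit, hcol, add_zero]
      -- the rest
      calc ‖∑ j ∈ box \ (Finset.Icc 1 u).image e, f j‖
          ≤ ∑ j ∈ box \ (Finset.Icc 1 u).image e, ‖f j‖ := norm_sum_le _ _
        _ ≤ ∑ j ∈ box \ (Finset.Icc 1 u).image e, w ^ t * (R * C j) := by
            refine Finset.sum_le_sum fun j hj => ?_
            obtain ⟨hjbox, hjI⟩ := Finset.mem_sdiff.mp hj
            have hs : t ≤ ∑ k ∈ Finset.univ.erase i, j k := le_frozenExp_of_not_mem_image i hjbox hjI
            have hji : j i ∈ Finset.Icc 1 u := Fintype.mem_piFinset.mp hjbox i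
            have hρR : ρ ^ (j i) ≤ R :=
              Finset.single_le_sum (f := fun m => ρ ^ m) (fun m _ => by positivity) hji
            have ha : 0 ≤ (jointCell t N u Ψ K j : ℝ) * w ^ (∑ k ∈ Finset.univ.erase i, j k) :=
              mul_nonneg (Nat.cast_nonneg _) (pow_nonneg hw0.le _)
            have hnorm : ‖f j‖ = C j * w ^ (∑ k ∈ Finset.univ.erase i, j k) * ρ ^ (j i) := by
              simp only [hf]
              rw [norm_mul, norm_pow, Complex.norm_real, Real.norm_eq_abs, abs_of_nonneg ha]
            rw [hnorm]
            calc C j * w ^ (∑ k ∈ Finset.univ.erase i, j k) * ρ ^ (j i)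
                ≤ C j * w ^ t * R := by
                  refine mul_le_mul (mul_le_mul_of_nonneg_left (pow_le_pow_of_le_one hw0.le hw1 hs) (hC0 j))
                    hρR (by positivity) ?_
                  exact mul_nonneg (hC0 j) (pow_nonneg hw0.le _)
              _ = w ^ t * (R * C j) := by ring
        _ ≤ ∑ j ∈ box, w ^ t * (R * C j) :=
            Finset.sum_le_sum_of_subset_of_nonneg Finset.sdiff_subset fun j _ _ =>
              mul_nonneg (pow_nonneg hw0.le t) (mul_nonneg hR0 (hC0 j))
        _ = w ^ t * (R * B) := by rw [hB, Finset.mul_sum, Finset.mul_sum]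
    -- combine
    calc (ρ + z.re) ^ u * (w ^ (t - 1) * S) ^ 2
        ≤ (ρ + z.re) ^ u * (Q.eval ρ) ^ 2 :=
          mul_le_mul_of_nonneg_left (pow_le_pow_left₀ (mul_nonneg hwt.le hSpos.le) hlow 2)
            (pow_nonneg hρx.le u)
      _ ≤ (2 * ρ) ^ u * ‖(Q.map (algebraMap ℝ ℂ)).eval z‖ ^ 2 := hLB
      _ ≤ (2 * ρ) ^ u * (w ^ t * (R * B)) ^ 2 :=
          mul_le_mul_of_nonneg_left (pow_le_pow_left₀ (norm_nonneg _) hUB 2)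
            (pow_nonneg (mul_nonneg zero_le_two hρpos.le) u)
  -- divide by `w^{2(t-1)}`: `(ρ + Re z)^u S² ≤ w · M` for every `0 < w ≤ 1`
  set A : ℝ := (ρ + z.re) ^ u * S ^ 2 with hA
  set M : ℝ := (2 * ρ) ^ u * (R * B) ^ 2 with hM
  have hApos : 0 < A := mul_pos (pow_pos hρx u) (pow_pos hSpos 2)
  have hM0 : 0 ≤ M := mul_nonneg (pow_nonneg (mul_nonneg zero_le_two hρpos.le) u) (sq_nonneg _)
  have hfin : ∀ w : ℝ, 0 < w → w ≤ 1 → A ≤ w * M := by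
    intro w hw0 hw1
    have h := main w hw0 hw1
    have hwt : 0 < w ^ (t - 1) := pow_pos hw0 _
    have hwsplit : w ^ t = w ^ (t - 1) * w := by rw [← pow_succ, Nat.sub_add_cancel ht1]
    have e1 : (ρ + z.re) ^ u * (w ^ (t - 1) * S) ^ 2 = (w ^ (t - 1)) ^ 2 * A := by rw [hA]; ring
    have e2 : (2 * ρ) ^ u * (w ^ t * (R * B)) ^ 2 = (w ^ (t - 1)) ^ 2 * (w ^ 2 * M) := by
      rw [hM, hwsplit]; ring
    rw [e1, e2] at h
    have h' : A ≤ w ^ 2 * M := le_of_mul_le_mul_left h (pow_pos hwt 2)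
    calc A ≤ w ^ 2 * M := h'
      _ ≤ w * M := mul_le_mul_of_nonneg_right (by nlinarith) hM0
  -- choose `w` small
  have hpos2 : 0 < 2 * (M + 1) := by linarith
  have hw : 0 < min 1 (A / (2 * (M + 1))) := lt_min one_pos (div_pos hApos hpos2)
  have h := hfin _ hw (min_le_left _ _)
  have h3 : min 1 (A / (2 * (M + 1))) * M ≤ A / (2 * (M + 1)) * M :=
    mul_le_mul_of_nonneg_right (min_le_right _ _) hM0
  have h4 : A / (2 * (M + 1)) * M < A := by
    have hlt : M / (2 * (M + 1)) < 1 := by rw [div_lt_one hpos2]; linarith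
    calc A / (2 * (M + 1)) * M = A * (M / (2 * (M + 1))) := by ring
      _ < A * 1 := mul_lt_mul_of_pos_left hlt hApos
      _ = A := mul_one A
  linarith

/-- **The crux forces every prime column to be real-rooted or zero, at every `t ≥ 1`** (the previous theorem fed
with the crux verbatim). For `t = 2`, `Ψ = (n, n + 2)`, `i = 0`: for all large `N` and every convex `K ⊆ [-N, N]` of
singular mass `≥ ηN`, the Ω-cell polynomial `Σ_m #{n ∈ K : n + 2 prime > N^{1/u}, P⁻(n) > N^{1/u}, Ω(n) = m} ζ^m` is
hyperbolic (or zero). -/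
theorem primeColumn_hyperbolic_of_fibreHyperbolicity :
    FibreHyperbolicity → ∀ t : ℕ, 1 ≤ t → ∀ (L u₀ : ℕ) (η : ℝ), 0 < η → ∃ u : ℕ, u₀ ≤ u ∧ 2 ≤ u ∧ ∃ N₀ : ℕ,
      ∀ N : ℕ, N₀ ≤ N → ∀ Ψ : Fin t → AffLinForm 1, IsNondegenerateSystem Ψ → affLinSize Ψ N ≤ L →
      ∀ K : Set (Fin 1 → ℝ), Convex ℝ K → K ⊆ realBox 1 N →
      η * (N : ℝ) ≤ archFactor Ψ K * singularProduct Ψ → ∀ i : Fin t,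
        (∀ m ∈ Finset.Icc 1 u, jointCell t N u Ψ K (Function.update (fun _ => 1) i m) = 0) ∨
        ∀ z : ℂ, (∑ m ∈ Finset.Icc 1 u,
            ((jointCell t N u Ψ K (Function.update (fun _ => 1) i m) : ℕ) : ℂ) * z ^ m) = 0 → z.im = 0 :=
  fun hF t ht => primeColumn_hyperbolic_of_FHAt (crux_iff.mp hF t ht)

end Summit.Parity.GeneralizedHardyLittlewood.Cruxes.FibreHyperbolicity.ModelTransfer

end
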